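import Literature.NumberTheory.LFunctions.KadiriTestFunction
import HarnessLib

/-!
# The boundary inequality of Kadiri's pair positivity: `Q(σ + iy) ≥ κ` from (H₂), Lemma 3.2 and the conditions `κ ≤ κ₂, κ₃` (Acta Arith. 117 (2005), proof of Prop. 4.2)

Topic `Literature/NumberTheory/LFunctions`. Everything in this file is PROVED (no named fact, no
definition). The strip minimum principle (`KadiriPairPositivity.lean`, `KadiriPair.pair_nonneg`)
reduces Kadiri's Prop. 4.2 to the inequality on the line `Re z = σ`,

  `F̃(0, y) + F̃(2σ−1, y) ≥ κ [F̃(δ, y) + F̃(2σ−1+δ, y)]`  for all real `y`,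

for the test function `f = ηh(η·)` (`kadiriTest θ η`). Kadiri (proof of Prop. 4.2, "Regardons
maintenant `Q` sur l'autre côté `0 ≤ y ≤ y₀, β = σ`") derives it from (H₂) (`F̃(0,y) ≥ 0`),
Lemma 3.2 in the third-order form `|F̃(x,y) − ηg₁x/(x²+y²)| ≤ mη³/(x(x²+y²))`
(`M(x/η) ≤ mη/x`, `m = max|h''|`), and the monotone replacements `2σ₀ − 1 ≤ 2σ − 1 ≤ 1`
(Mossinghoff–Trudgian 2015 §2 write `κ₂, κ₃` with `2σ₀ − 1`), which leave the rational
inequality "`Q₂(y) ≥ κ`":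

  `N₀/(1 + y²) ≥ κ [B₀/(δ² + y²) + C₀/(e₀² + y²)]`,
  `N₀ = g₁a₀ − mη₀²/a₀`, `B₀ = g₁δ + mη₀²/δ`, `C₀ = g₁(1+δ) + mη₀²/e₀`, `a₀ = 2σ₀ − 1`, `e₀ = a₀ + δ`.

Here this last inequality (for all `y`, equivalently a quadratic inequality in `Y = y²`) is the
HYPOTHESIS, to be checked per round of the computation with the round's constants
(`quad_nonneg_of_coeff` gives the finite criterion: leading and constant coefficients `≥ 0` and
middle coefficient `≥ 0` or discriminant `≤ 0`); Kadiri's `κ₂(δ)` and `κ₃(δ)` are its values at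
`y = 0` and `y → ∞`.

* `Literature.NumberTheory.LFunctions.KadiriBoundary.mtyM_le_div` — `M(z) ≤ m/z` (`z > 0`);
* `Literature.NumberTheory.LFunctions.KadiriBoundary.re_fordLaplace_le`, `re_fordLaplace_ge` —
  `η(g₁x ∓ mη²/x)/(x²+y²)` bounds for `F̃(x, y)`, `x > 0`;
* `Literature.NumberTheory.LFunctions.KadiriBoundary.boundary_ineq` — the displayed reduction;
* `Literature.NumberTheory.LFunctions.KadiriBoundary.quad_nonneg_of_coeff`.

## References

* H. Kadiri, *Une région explicite sans zéros pour la fonction ζ de Riemann*, Acta Arith. 117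
  (2005) = arXiv:math/0401238, proof of Prop. 4.2, (k2), (k3), Lemma 3.2. (`Kadiri2005`)
* M. J. Mossinghoff, T. S. Trudgian, J. Number Theory 157 (2015) = arXiv:1410.3926, §2 (`κ₂`,
  `κ₃` with `2σ₀ − 1`). (`MossinghoffTrudgian2015`)
-/

noncomputable section

open Complex Real MeasureTheory Set

namespace Literature.NumberTheory.LFunctions

namespace KadiriBoundary

variable {θ η : ℝ}

/-! ## `M(z) ≤ m/z` -/

/-- **`M(z) ≤ m/z` for `z > 0`**, `m ≥ max_{[0,d₁]} |h''|` (Kadiri, Lemma 3.2: "la majoration par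
`m/z` donne une approximation de `M` suffisante"). [cite: Kadiri2005, Lemma 3.2] -/
theorem mtyM_le_div (hθ : 0 < θ) (hθ' : θ < π / 2) {m : ℝ}
    (hm : ∀ u ∈ Icc 0 (mtyD1 θ), |mtyH1Deriv2 1 θ u| ≤ m) {z : ℝ} (hz : 0 < z) :
    mtyM θ z ≤ m / z := by
  have hD := KadiriTest.mtyD1_pos hθ hθ'
  have hm0 : 0 ≤ m := (abs_nonneg _).trans (hm 0 ⟨le_rfl, hD.le⟩)
  unfold mtyM
  have h1 : ∫ u in (0 : ℝ)..mtyD1 θ, |mtyH1Deriv2 1 θ u| * Real.exp (-(z * u)) ≤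
      ∫ u in (0 : ℝ)..mtyD1 θ, m * Real.exp (-(z * u)) := by
    refine intervalIntegral.integral_mono_on hD.le ?_ ?_ fun u hu ↦ ?_
    · exact ((continuous_abs.comp (continuous_mtyH1Deriv2 1 θ)).mul (by fun_prop)).intervalIntegrable _ _
    · exact (continuous_const.mul (by fun_prop)).intervalIntegrable _ _
    · exact mul_le_mul_of_nonneg_right (hm u hu) (Real.exp_nonneg _)
  have h2 : ∫ u in (0 : ℝ)..mtyD1 θ, m * Real.exp (-(z * u)) = m * ((1 - Real.exp (-(z * mtyD1 θ))) / z) := by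
    rw [intervalIntegral.integral_const_mul]
    congr 1
    have hderiv : ∀ u ∈ uIcc 0 (mtyD1 θ), HasDerivAt (fun u : ℝ ↦ -Real.exp (-(z * u)) / z) (Real.exp (-(z * u))) u := by
      intro u _
      have h := ((hasDerivAt_id u).const_mul z).neg.exp
      have h' := (h.neg).div_const z
      refine h'.congr_deriv ?_
      field_simp
      simp
    rw [intervalIntegral.integral_eq_sub_of_hasDerivAt hderiv ((by fun_prop : Continuous fun u : ℝ ↦ Real.exp (-(z * u))).intervalIntegrable _ _)]
    simp
    field_simp
    ring
  have h3 : m * ((1 - Real.exp (-(z * mtyD1 θ))) / z) ≤ m / z := by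
    rw [mul_div_assoc']
    refine div_le_div_of_nonneg_right ?_ hz.le
    nlinarith [Real.exp_nonneg (-(z * mtyD1 θ))]
  linarith

/-! ## Third-order bounds for `F̃(x, y)`, `x > 0` -/

/-- **Upper bound** `F̃(x, y) ≤ η(g₁x + mη²/x)/(x² + y²)` (`x > 0`). [cite: Kadiri2005, Lemma 3.2] -/
theorem re_fordLaplace_le (hθ : 0 < θ) (hθ' : θ < π / 2) (hη : 0 < η) {m : ℝ}
    (hm : ∀ u ∈ Icc 0 (mtyD1 θ), |mtyH1Deriv2 1 θ u| ≤ m) {x : ℝ} (hx : 0 < x) (y : ℝ) :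
    (fordLaplace (kadiriTest θ η) ((x : ℂ) + y * I)).re ≤
      η * (fordSmoothW0 θ * x + m * η ^ 2 / x) / (x ^ 2 + y ^ 2) := by
  set z : ℂ := (x : ℂ) + y * I with hz
  have hzre : z.re = x := by simp [hz]
  have hz0 : z ≠ 0 := fun h ↦ by have := congrArg Complex.re h; rw [hzre] at this; simp at this; linarith
  have hn : ‖z‖ ^ 2 = x ^ 2 + y ^ 2 := by rw [Complex.sq_norm, Complex.normSq_apply]; simp [hz]; ring
  have hL := KadiriTest.abs_re_fordLaplace_sub_le hθ hθ' hη hz0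
  rw [hzre, hn] at hL
  have hM : mtyM θ (x / η) ≤ m / (x / η) := mtyM_le_div hθ hθ' hm (by positivity)
  have hpos : 0 < x ^ 2 + y ^ 2 := by positivity
  have h1 := (abs_le.1 hL).2
  have h2 : mtyM θ (x / η) * η ^ 2 / (x ^ 2 + y ^ 2) ≤ (m / (x / η)) * η ^ 2 / (x ^ 2 + y ^ 2) := by
    gcongr
  have e : η * fordSmoothW0 θ * x / (x ^ 2 + y ^ 2) + (m / (x / η)) * η ^ 2 / (x ^ 2 + y ^ 2) =
      η * (fordSmoothW0 θ * x + m * η ^ 2 / x) / (x ^ 2 + y ^ 2) := by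
    field_simp
  linarith

/-- **Lower bound** `F̃(x, y) ≥ η(g₁x − mη²/x)/(x² + y²)` (`x > 0`). [cite: Kadiri2005, Lemma 3.2] -/
theorem re_fordLaplace_ge (hθ : 0 < θ) (hθ' : θ < π / 2) (hη : 0 < η) {m : ℝ}
    (hm : ∀ u ∈ Icc 0 (mtyD1 θ), |mtyH1Deriv2 1 θ u| ≤ m) {x : ℝ} (hx : 0 < x) (y : ℝ) :
    η * (fordSmoothW0 θ * x - m * η ^ 2 / x) / (x ^ 2 + y ^ 2) ≤
      (fordLaplace (kadiriTest θ η) ((x : ℂ) + y * I)).re := by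
  set z : ℂ := (x : ℂ) + y * I with hz
  have hzre : z.re = x := by simp [hz]
  have hz0 : z ≠ 0 := fun h ↦ by have := congrArg Complex.re h; rw [hzre] at this; simp at this; linarith
  have hn : ‖z‖ ^ 2 = x ^ 2 + y ^ 2 := by rw [Complex.sq_norm, Complex.normSq_apply]; simp [hz]; ring
  have hL := KadiriTest.abs_re_fordLaplace_sub_le hθ hθ' hη hz0
  rw [hzre, hn] at hL
  have hM : mtyM θ (x / η) ≤ m / (x / η) := mtyM_le_div hθ hθ' hm (by positivity)
  have hpos : 0 < x ^ 2 + y ^ 2 := by positivity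
  have h1 := (abs_le.1 hL).1
  have h2 : mtyM θ (x / η) * η ^ 2 / (x ^ 2 + y ^ 2) ≤ (m / (x / η)) * η ^ 2 / (x ^ 2 + y ^ 2) := by
    gcongr
  have e : η * fordSmoothW0 θ * x / (x ^ 2 + y ^ 2) - (m / (x / η)) * η ^ 2 / (x ^ 2 + y ^ 2) =
      η * (fordSmoothW0 θ * x - m * η ^ 2 / x) / (x ^ 2 + y ^ 2) := by
    field_simp
  linarith

/-! ## The boundary inequality from the rational condition -/

/-- **Kadiri's boundary inequality** (proof of Prop. 4.2, side `β = σ`; Mossinghoff–Trudgian's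
`κ₂, κ₃` with `a₀ = 2σ₀ − 1`). Let `0 < η ≤ η₀`, `1/2 < σ₀ ≤ σ ≤ 1`, `δ > 0`, `κ ≥ 0`, `m ≥ |h''|`
on `[0, d₁]`, and put `g₁ = fordSmoothW0 θ`, `a₀ = 2σ₀−1`, `e₀ = a₀+δ`, `N₀ = g₁a₀ − mη₀²/a₀`,
`B₀ = g₁δ + mη₀²/δ`, `C₀ = g₁(1+δ) + mη₀²/e₀`. If `N₀ ≥ 0` and
`N₀/(1+y²) ≥ κ[B₀/(δ²+y²) + C₀/(e₀²+y²)]` for all `y`, then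
`κ[F̃(δ,y) + F̃(2σ−1+δ,y)] ≤ F̃(0,y) + F̃(2σ−1,y)` for all `y` (the hypothesis `hB` of
`KadiriPair.pair_nonneg`). [cite: Kadiri2005, Prop. 4.2 (proof)] -/
theorem boundary_ineq (hθ : 0 < θ) (hθ' : θ < π / 2) (hη : 0 < η) {η₀ σ₀ σ δ κ m : ℝ}
    (hηη₀ : η ≤ η₀) (hσ₀ : 1 / 2 < σ₀) (hσ₀σ : σ₀ ≤ σ) (hσ1 : σ ≤ 1) (hδ : 0 < δ) (hκ : 0 ≤ κ)
    (hm : ∀ u ∈ Icc 0 (mtyD1 θ), |mtyH1Deriv2 1 θ u| ≤ m)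
    (hN₀ : 0 ≤ fordSmoothW0 θ * (2 * σ₀ - 1) - m * η₀ ^ 2 / (2 * σ₀ - 1))
    (hQ : ∀ y : ℝ, κ * ((fordSmoothW0 θ * δ + m * η₀ ^ 2 / δ) / (δ ^ 2 + y ^ 2) +
        (fordSmoothW0 θ * (1 + δ) + m * η₀ ^ 2 / (2 * σ₀ - 1 + δ)) / ((2 * σ₀ - 1 + δ) ^ 2 + y ^ 2)) ≤
      (fordSmoothW0 θ * (2 * σ₀ - 1) - m * η₀ ^ 2 / (2 * σ₀ - 1)) / (1 + y ^ 2))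
    (y : ℝ) :
    κ * ((fordLaplace (kadiriTest θ η) ((δ : ℂ) + y * I)).re +
        (fordLaplace (kadiriTest θ η) (((2 * σ - 1 + δ : ℝ) : ℂ) + y * I)).re) ≤
      (fordLaplace (kadiriTest θ η) (((0 : ℝ) : ℂ) + y * I)).re +
        (fordLaplace (kadiriTest θ η) (((2 * σ - 1 : ℝ) : ℂ) + y * I)).re := by
  set g₁ := fordSmoothW0 θ with hg
  have hg0 : 0 < g₁ := fordSmoothW0_pos hθ hθ'
  have hm0 : 0 ≤ m := (abs_nonneg _).trans (hm 0 ⟨le_rfl, (KadiriTest.mtyD1_pos hθ hθ').le⟩)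
  set a : ℝ := 2 * σ - 1 with ha
  set a₀ : ℝ := 2 * σ₀ - 1 with ha₀
  set e : ℝ := 2 * σ - 1 + δ with he
  set e₀ : ℝ := 2 * σ₀ - 1 + δ with he₀
  have ha₀0 : 0 < a₀ := by rw [ha₀]; linarith
  have haa₀ : a₀ ≤ a := by rw [ha, ha₀]; linarith
  have ha1 : a ≤ 1 := by rw [ha]; linarith
  have ha0 : 0 < a := by linarith
  have he₀0 : 0 < e₀ := by rw [he₀]; linarith
  have hee₀ : e₀ ≤ e := by rw [he, he₀]; linarith
  have he1 : e ≤ 1 + δ := by rw [he]; linarith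
  have he0 : 0 < e := by linarith
  have hη2 : η ^ 2 ≤ η₀ ^ 2 := pow_le_pow_left₀ hη.le hηη₀ 2
  -- (H₂) at `x = 0`
  have h0 : 0 ≤ (fordLaplace (kadiriTest θ η) (((0 : ℝ) : ℂ) + y * I)).re :=
    KadiriTest.re_fordLaplace_nonneg hθ hθ' hη le_rfl y
  -- the three Lemma 3.2 bounds
  have hA := re_fordLaplace_ge hθ hθ' hη hm ha0 y
  have hBδ := re_fordLaplace_le hθ hθ' hη hm hδ y
  have hCe := re_fordLaplace_le hθ hθ' hη hm he0 y
  -- monotone replacements (in `η` and in `a`)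
  have hy2 : 0 ≤ y ^ 2 := sq_nonneg y
  have rA : η * (g₁ * a₀ - m * η₀ ^ 2 / a₀) / (1 + y ^ 2) ≤ η * (g₁ * a - m * η ^ 2 / a) / (a ^ 2 + y ^ 2) := by
    have h1 : g₁ * a₀ - m * η₀ ^ 2 / a₀ ≤ g₁ * a - m * η ^ 2 / a := by
      have : m * η ^ 2 / a ≤ m * η₀ ^ 2 / a₀ := by
        rw [div_le_div_iff₀ ha0 ha₀0]
        have := mul_le_mul hη2 haa₀ ha₀0.le (sq_nonneg η₀)
        nlinarith
      nlinarith
    have h2 : 0 ≤ g₁ * a - m * η ^ 2 / a := hN₀.trans h1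
    have h3 : a ^ 2 + y ^ 2 ≤ 1 + y ^ 2 := by nlinarith [mul_le_mul ha1 ha1 ha0.le zero_le_one]
    calc η * (g₁ * a₀ - m * η₀ ^ 2 / a₀) / (1 + y ^ 2)
        ≤ η * (g₁ * a - m * η ^ 2 / a) / (1 + y ^ 2) :=
          div_le_div_of_nonneg_right (mul_le_mul_of_nonneg_left h1 hη.le) (by positivity)
      _ ≤ η * (g₁ * a - m * η ^ 2 / a) / (a ^ 2 + y ^ 2) :=
          div_le_div_of_nonneg_left (mul_nonneg hη.le h2) (by positivity) h3
  have rB : η * (g₁ * δ + m * η ^ 2 / δ) / (δ ^ 2 + y ^ 2) ≤ η * (g₁ * δ + m * η₀ ^ 2 / δ) / (δ ^ 2 + y ^ 2) :=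
    div_le_div_of_nonneg_right (mul_le_mul_of_nonneg_left (add_le_add_right
      (div_le_div_of_nonneg_right (mul_le_mul_of_nonneg_left hη2 hm0) hδ.le) _) hη.le) (by positivity)
  have rC : η * (g₁ * e + m * η ^ 2 / e) / (e ^ 2 + y ^ 2) ≤ η * (g₁ * (1 + δ) + m * η₀ ^ 2 / e₀) / (e₀ ^ 2 + y ^ 2) := by
    have h1 : g₁ * e + m * η ^ 2 / e ≤ g₁ * (1 + δ) + m * η₀ ^ 2 / e₀ := by
      have : m * η ^ 2 / e ≤ m * η₀ ^ 2 / e₀ := by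
        rw [div_le_div_iff₀ he0 he₀0]
        have := mul_le_mul hη2 hee₀ he₀0.le (sq_nonneg η₀)
        nlinarith
      nlinarith
    have h3 : e₀ ^ 2 + y ^ 2 ≤ e ^ 2 + y ^ 2 := add_le_add_left (pow_le_pow_left₀ he₀0.le hee₀ 2) _
    have hnum0 : 0 ≤ g₁ * (1 + δ) + m * η₀ ^ 2 / e₀ :=
      add_nonneg (mul_nonneg hg0.le (by linarith)) (div_nonneg (mul_nonneg hm0 (sq_nonneg _)) he₀0.le)
    calc η * (g₁ * e + m * η ^ 2 / e) / (e ^ 2 + y ^ 2)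
        ≤ η * (g₁ * (1 + δ) + m * η₀ ^ 2 / e₀) / (e ^ 2 + y ^ 2) :=
          div_le_div_of_nonneg_right (mul_le_mul_of_nonneg_left h1 hη.le) (by positivity)
      _ ≤ η * (g₁ * (1 + δ) + m * η₀ ^ 2 / e₀) / (e₀ ^ 2 + y ^ 2) :=
          div_le_div_of_nonneg_left (mul_nonneg hη.le hnum0) (by positivity) h3
  -- the rational hypothesis, multiplied by `η`
  have hQy := mul_le_mul_of_nonneg_left (hQ y) hη.le
  have eL : η * (κ * ((g₁ * δ + m * η₀ ^ 2 / δ) / (δ ^ 2 + y ^ 2) +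
      (g₁ * (1 + δ) + m * η₀ ^ 2 / e₀) / (e₀ ^ 2 + y ^ 2))) =
      κ * (η * (g₁ * δ + m * η₀ ^ 2 / δ) / (δ ^ 2 + y ^ 2) +
        η * (g₁ * (1 + δ) + m * η₀ ^ 2 / e₀) / (e₀ ^ 2 + y ^ 2)) := by ring
  have eR : η * ((g₁ * a₀ - m * η₀ ^ 2 / a₀) / (1 + y ^ 2)) = η * (g₁ * a₀ - m * η₀ ^ 2 / a₀) / (1 + y ^ 2) := by
    ring
  rw [eL, eR] at hQy
  have hk := mul_le_mul_of_nonneg_left (add_le_add (hBδ.trans rB) (hCe.trans rC)) hκ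
  linarith

/-! ## A finite criterion for the rational condition -/

/-- **Non-negativity of a quadratic on `[0, ∞)`**: if `α ≥ 0`, `γ ≥ 0` and (`β ≥ 0` or
`β² ≤ 4αγ`) then `αY² + βY + γ ≥ 0` for all `Y ≥ 0`. [folklore] -/
theorem quad_nonneg_of_coeff {α β γ : ℝ} (hα : 0 ≤ α) (hγ : 0 ≤ γ) (hβ : 0 ≤ β ∨ β ^ 2 ≤ 4 * α * γ)
    {Y : ℝ} (hY : 0 ≤ Y) : 0 ≤ α * Y ^ 2 + β * Y + γ := by
  rcases hβ with hβ | hβ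
  · positivity
  · rcases hα.eq_or_lt with h | h
    · rw [← h] at hβ ⊢
      have : β = 0 := by nlinarith
      rw [this]; linarith
    · -- complete the square: `4α(αY²+βY+γ) = (2αY+β)² + (4αγ − β²)`
      have key : 4 * α * (α * Y ^ 2 + β * Y + γ) = (2 * α * Y + β) ^ 2 + (4 * α * γ - β ^ 2) := by ring
      nlinarith [sq_nonneg (2 * α * Y + β)]

/-- The rational condition of `boundary_ineq` as a quadratic in `Y = y²`: it holds for all `y` as
soon as the quadratic `N₀(δ²+Y)(e₀²+Y) − κ(1+Y)[B₀(e₀²+Y) + C₀(δ²+Y)]` has coefficients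
satisfying `quad_nonneg_of_coeff`. [cite: Kadiri2005, Prop. 4.2 (proof, κ₂ and κ₃)] -/
theorem rational_condition_of_quad {g₁ m η₀ σ₀ δ κ : ℝ} (hδ : 0 < δ) (hσ₀ : 1 / 2 < σ₀)
    (hquad : ∀ Y : ℝ, 0 ≤ Y →
      κ * (1 + Y) * ((g₁ * δ + m * η₀ ^ 2 / δ) * ((2 * σ₀ - 1 + δ) ^ 2 + Y) +
          (g₁ * (1 + δ) + m * η₀ ^ 2 / (2 * σ₀ - 1 + δ)) * (δ ^ 2 + Y)) ≤
        (g₁ * (2 * σ₀ - 1) - m * η₀ ^ 2 / (2 * σ₀ - 1)) * ((δ ^ 2 + Y) * ((2 * σ₀ - 1 + δ) ^ 2 + Y)))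
    (y : ℝ) :
    κ * ((g₁ * δ + m * η₀ ^ 2 / δ) / (δ ^ 2 + y ^ 2) +
        (g₁ * (1 + δ) + m * η₀ ^ 2 / (2 * σ₀ - 1 + δ)) / ((2 * σ₀ - 1 + δ) ^ 2 + y ^ 2)) ≤
      (g₁ * (2 * σ₀ - 1) - m * η₀ ^ 2 / (2 * σ₀ - 1)) / (1 + y ^ 2) := by
  have he₀ : 0 < 2 * σ₀ - 1 + δ := by linarith
  have h1 : 0 < δ ^ 2 + y ^ 2 := by positivity
  have h2 : 0 < (2 * σ₀ - 1 + δ) ^ 2 + y ^ 2 := by positivity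
  have h3 : 0 < 1 + y ^ 2 := by positivity
  have hq := hquad (y ^ 2) (sq_nonneg y)
  rw [mul_add, mul_div_assoc', mul_div_assoc', div_add_div _ _ h1.ne' h2.ne',
    div_le_div_iff₀ (by positivity) h3]
  nlinarith [hq]

end KadiriBoundary

end Literature.NumberTheory.LFunctions
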